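import Literature.AlgebraicGeometry.AbelianSchemes.AbelianSchemeKOfLConstantOfLevelStructure
import HarnessLib

/-!
# `K(L)` over a disconnected base with a level structure: gluing the constant subgroup of sections across a clopen partition

Layer `Literature/AlgebraicGeometry/AbelianSchemes`, namespace `Literature.AlgebraicGeometry.AbelianSchemes.AbelianSchemeOver`.
THEOREMS ONLY (no definition, no named fact, no instance, no notation, no `sorry`).  Cell `hodgecm-mathlib` (D-0151),
FLOOR-0 programme P1, F-3 child line (M) `Cruxes/HDel/Lines/F3DualAbelianSchemeM`, letter (Ma) ed. 4 (B-typ04 (g15);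
B-plan1 (g19) ruling r-conn 2026-08-30 19:36Z: `Spec R` connected, the finite subgroup `K′` GLUED across the connected
components of the level-basis torsor `S′` = repair (r2) of B-p19 (g18)'s letter-risk note 19:34Z).  Sequel of ★-in-HOME
`AbelianSchemeKOfLConstantOfLevelStructure` (the connected-piece core).  Author B-p19 (g18); count-neutral capital.
HC_CM is proved only modulo the 7 printed citations until rung 0 closes; nothing here is about HC.

## What is proved ([MumfordAV1970] §13; [MumfordFogartyKirwan1994] Ch. 7 §2 Prop. 7.3 step (IV))

* `memKOfL_of_forall_comp` — **`K(L)` is a Zariski sheaf**: when `K(L)` is represented by a monomorphism `Z ↪ A`,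
  membership of a `T`-point is local on `T` along any jointly surjective family of open immersions over `S` (the local
  factorisations through `Z` glue, Mathlib `Scheme.Cover.glueMorphisms`).
* `exists_subgroup_sections_glue` — finite subgroups `K k` of the `U k`-points of `A` on the pieces of a clopen partition
  `S = ⊔ₖ U k`, identified with ONE finite group `Γ` by isomorphisms `e k`, glue to a finite subgroup `K′` of GLOBAL
  sections whose restriction to each piece is a bijection onto `K k` (★ `Morphisms.exists_glue_local_of_pairwise_disjoint`).
* `exists_finite_subgroup_memKOfL_iff_of_levelStructure_of_partition` — the (Ma)-shaped conclusion over a base with a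
  clopen partition into PRECONNECTED pieces: a FINITE subgroup `K′` of sections, INJECTIVE on every geometric fibre, with
  `u ∈ K(L)(T)` iff `u` is locally the restriction of a member of `K′` — from the connected-piece core
  ★ `finite_kOfL_and_injective_and_memKOfL_iff_of_levelStructure_on_opens` and the glue, given group isomorphisms
  `e k : K(L)(U k) ≃* Γ` (in (Ma): evaluation at geometric points `c_k ∈ U k` over ONE geometric point `s̄₀` of the
  connected `Spec R` — every component of the finite étale `S′ → Spec R` surjects, ★
  `Morphisms.exists_clopen_connected_component_surjective_of_mem_of_isLocallyNoetherian`).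

## References
* [MumfordAV1970] D. Mumford, *Abelian Varieties* (1970), §13 (p. 123) and §7 Thm. 4 (p. 72).
* [MumfordFogartyKirwan1994] D. Mumford, J. Fogarty, F. Kirwan, *Geometric Invariant Theory*, 3rd ed. (1994), Ch. 7 §2
  Proposition 7.3, proof, step (IV) (pp. 133–134).
* [GortzWedhorn2023] U. Görtz, T. Wedhorn, *Algebraic Geometry II* (2023), Prop. 27.188 (1) (p. 675).
* [GortzWedhorn2020] U. Görtz, T. Wedhorn, *Algebraic Geometry I*, 2nd ed. (2020), Prop. 3.5 (gluing of morphisms).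
-/

noncomputable section

universe u

open CategoryTheory CategoryTheory.Limits AlgebraicGeometry MonoidalCategory CartesianMonoidalCategory

open scoped MonObj Obj

namespace Literature.AlgebraicGeometry.AbelianSchemes

open Literature.AlgebraicGeometry.Modules Literature.AlgebraicGeometry.Motives Literature.AlgebraicGeometry.AbelianVarieties
  Literature.AlgebraicGeometry.Morphisms

namespace AbelianSchemeOver

variable {S : Scheme.{u}} (A : AbelianSchemeOver S)

/-! ## Gluing across a clopen partition of the base (the disconnected level-basis torsor) -/

/-- **`K(L)` is a Zariski sheaf** (when represented by a monomorphism `i : Z ↪ A`): if a `T`-point `u` of `A` lies in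
`K(L)` after restriction to the members of a jointly surjective family of open immersions `P k ⟶ T` over `S`, then
`u ∈ K(L)(T)` — the local factorisations through `Z` agree on overlaps (`i` is a monomorphism) and glue (Mathlib
`Scheme.Cover.glueMorphisms`). [cite: MumfordAV1970, §13 (p. 123)] [cite: GortzWedhorn2020, Prop. 3.5] -/
theorem memKOfL_of_forall_comp (L : A.left.Modules) {Z : Over S} (i : Z ⟶ A.X) [Mono i.left]
    (hZ : ∀ (T : Over S) (u : T ⟶ A.X), (∃ v : T ⟶ Z, v ≫ i = u) ↔ A.MemKOfL L u)
    {T : Over S} (u : T ⟶ A.X) {κ : Type u} (P : κ → Over S) (gP : ∀ k, P k ⟶ T)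
    [∀ k, IsOpenImmersion (gP k).left] (hsurj : ∀ t : T.left, ∃ k y, (gP k).left y = t)
    (h : ∀ k, A.MemKOfL L (gP k ≫ u)) : A.MemKOfL L u := by
  classical
  let 𝒱 : T.left.OpenCover := Scheme.Cover.mkOfCovers κ (fun k => (P k).left) (fun k => (gP k).left) hsurj
  choose vk hvk using fun k => (hZ _ _).2 (h k)
  let vkL : ∀ k, 𝒱.X k ⟶ Z.left := fun k => (vk k).left
  have hvkL : ∀ k, vkL k ≫ i.left = 𝒱.f k ≫ u.left := fun k => by
    change (vk k ≫ i).left = (gP k ≫ u).left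
    rw [hvk k]
  have hcompat : ∀ k k', pullback.fst (𝒱.f k) (𝒱.f k') ≫ vkL k = pullback.snd (𝒱.f k) (𝒱.f k') ≫ vkL k' := by
    intro k k'
    rw [← cancel_mono i.left, Category.assoc, Category.assoc, hvkL, hvkL, pullback.condition_assoc]
  let vL : T.left ⟶ Z.left := Scheme.Cover.glueMorphisms 𝒱 vkL hcompat
  have hvL : ∀ k, 𝒱.f k ≫ vL = vkL k := fun k => Scheme.Cover.ι_glueMorphisms 𝒱 _ hcompat k
  have hvLi : vL ≫ i.left = u.left :=
    Scheme.Cover.hom_ext 𝒱 _ _ fun k => by rw [← Category.assoc, hvL, hvkL]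
  have hvLS : vL ≫ Z.hom = T.hom := by
    rw [← Over.w i, ← Category.assoc, hvLi]; exact Over.w u
  exact (hZ T u).1 ⟨Over.homMk vL hvLS, Over.OverMorphism.ext (by change vL ≫ i.left = u.left; exact hvLi)⟩

/-- **Gluing finite subgroups of sections across a clopen partition.**  Let `S = ⊔ₖ U k` be a clopen partition and,
on each piece, `K k` a subgroup of the `U k`-points of `A`, all identified with ONE finite group `Γ` by group
isomorphisms `e k`.  Then the glued sections `σ_x := ⊔ₖ (e k)⁻¹ x` (`x ∈ Γ`) form a finite subgroup `K′` of GLOBAL sections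
whose restriction to every piece is a bijection onto `K k`; in particular a member of `K′` is determined by its restriction
to any one piece.  (Gluing: ★ `Morphisms.exists_glue_local_of_pairwise_disjoint`; multiplicativity is checked piecewise.)
Used to assemble `K(L)(S′)`'s constant part on the disconnected level-basis torsor `S′` of letter (Ma0) from the connected
components, identified through a common geometric point of the connected base `Spec R`. [cite: MumfordAV1970, §13 (p. 123)]
[cite: MumfordFogartyKirwan1994, Ch. 7 §2 Proposition 7.3, proof step (IV) (pp. 133–134)] [cite: GortzWedhorn2020, Prop. 3.5] -/
theorem exists_subgroup_sections_glue {κ : Type u} (U : κ → S.Opens) (hU : TopologicalSpace.IsOpenCover U)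
    (hdisj : ∀ k k', k ≠ k' → Disjoint (U k : Set S) (U k')) (K : ∀ k, Subgroup (Over.mk (U k).ι ⟶ A.X))
    {Γ : Type*} [Group Γ] [Finite Γ] (e : ∀ k, K k ≃* Γ) :
    ∃ K' : Subgroup A.Sections, Finite K' ∧
      (∀ k (σ : A.Sections), σ ∈ K' → toUnit (Over.mk (U k).ι) ≫ σ ∈ K k) ∧
      (∀ k (τ : Over.mk (U k).ι ⟶ A.X), τ ∈ K k → ∃ σ ∈ K', toUnit (Over.mk (U k).ι) ≫ σ = τ) ∧
      (∀ k (σ σ' : A.Sections), σ ∈ K' → σ' ∈ K' →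
        toUnit (Over.mk (U k).ι) ≫ σ = toUnit (Over.mk (U k).ι) ≫ σ' → σ = σ') := by
  classical
  let 𝒱 : S.OpenCover := S.openCoverOfIsOpenCover U hU
  -- sections are determined by their restrictions to the pieces
  have hext : ∀ σ σ' : A.Sections, (∀ k, toUnit (Over.mk (U k).ι) ≫ σ = toUnit (Over.mk (U k).ι) ≫ σ') → σ = σ' := by
    intro σ σ' hk
    refine Over.OverMorphism.ext (Scheme.Cover.hom_ext 𝒱 _ _ fun k => ?_)
    have := congrArg (fun f : Over.mk (U k).ι ⟶ A.X => f.left) (hk k)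
    simp only [Over.comp_left, Over.toUnit_left] at this
    exact this
  -- glue the local sections `(e k)⁻¹ x`
  choose F hF using fun x : Γ =>
    exists_glue_local_of_pairwise_disjoint U hU hdisj (fun k => ((e k).symm x : Over.mk (U k).ι ⟶ A.X).left)
  have hFS : ∀ x, F x ≫ A.X.hom = 𝟙 S := fun x =>
    Scheme.Cover.hom_ext 𝒱 _ _ fun k => by
      change (U k).ι ≫ F x ≫ A.X.hom = (U k).ι ≫ 𝟙 S
      rw [← Category.assoc, hF x k, Category.comp_id]
      exact Over.w ((e k).symm x : Over.mk (U k).ι ⟶ A.X)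
  let σ : Γ → A.Sections := fun x => Over.homMk (F x) (hFS x)
  have hres : ∀ k x, toUnit (Over.mk (U k).ι) ≫ σ x = ((e k).symm x : Over.mk (U k).ι ⟶ A.X) := fun k x =>
    Over.OverMorphism.ext (by
      change (toUnit (Over.mk (U k).ι)).left ≫ F x = _
      rw [Over.toUnit_left]; exact hF x k)
  let θ : Γ →* A.Sections := MonoidHom.mk' σ (fun x y => hext _ _ fun k => by
    rw [hres, MonObj.comp_mul, hres, hres, map_mul, Subgroup.coe_mul])
  refine ⟨θ.range, ?_, ?_, ?_, ?_⟩
  · exact Finite.of_surjective _ θ.rangeRestrict_surjective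
  · rintro k τ ⟨x, rfl⟩
    change toUnit (Over.mk (U k).ι) ≫ σ x ∈ K k
    rw [hres]; exact ((e k).symm x).2
  · intro k τ hτ
    refine ⟨θ (e k ⟨τ, hτ⟩), ⟨_, rfl⟩, ?_⟩
    change toUnit (Over.mk (U k).ι) ≫ σ (e k ⟨τ, hτ⟩) = τ
    rw [hres, MulEquiv.symm_apply_apply]
  · rintro k _ _ ⟨x, rfl⟩ ⟨y, rfl⟩ hxy
    change toUnit (Over.mk (U k).ι) ≫ σ x = toUnit (Over.mk (U k).ι) ≫ σ y at hxy
    rw [hres, hres] at hxy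
    have : x = y := (e k).symm.injective (Subtype.ext hxy)
    rw [this]

/-- **`K(L)` over a base with a clopen partition into PRECONNECTED pieces carrying a (global) level structure** — the
shape of letter (Ma) ed. 4 over the (disconnected) level-basis torsor `S′`: given, in the situation of
`finite_kOfL_and_injective_and_memKOfL_iff_of_levelStructure_on_opens`, a clopen partition `S = ⊔ₖ U k` with each `U k`
preconnected and group isomorphisms `e k : K(L)(U k) ≃* Γ` with one finite group (in (Ma): evaluation at geometric points
`c_k ∈ U k` over a common geometric point of the connected `Spec R`), there is a FINITE subgroup `K′` of global sections,
INJECTIVE on every geometric fibre, with `u ∈ K(L)(T)` iff `u` is locally the restriction of a member of `K′`.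
[cite: MumfordAV1970, §13 (p. 123)] [cite: MumfordFogartyKirwan1994, Ch. 7 §2 Proposition 7.3, proof step (IV) (pp. 133–134)]
[cite: GortzWedhorn2023, Prop. 27.188 (1) (p. 675)] -/
theorem exists_finite_subgroup_memKOfL_iff_of_levelStructure_of_partition [IsCommMonObj A.X]
    (L : A.left.Modules) (hL : HasRank L 1)
    (hε : CechPic.pullback A.unitSection (detClass (HasRank.isFiniteLocallyFree' hL)) = 1)
    {g M : ℕ} [NeZero M] (φ : LevelStructure g M A)
    {AM : Over S} (incl : AM ⟶ A.X) [IsFinite AM.hom] [Etale AM.hom]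
    (hpow : ∀ (Y : Over S) (w : Y ⟶ AM), (w ≫ incl) ^ M = 1)
    (hlift : ∀ (Y : Over S) (z : Y ⟶ A.X), z ^ M = 1 → ∃ w : Y ⟶ AM, w ≫ incl = z)
    (hinj : ∀ (Y : Over S) (w w' : Y ⟶ AM), w ≫ incl = w' ≫ incl → w = w')
    {Z : Over S} (i : Z ⟶ A.X) [IsClosedImmersion i.left] [Etale Z.hom]
    (hZ : ∀ (T : Over S) (u : T ⟶ A.X), (∃ v : T ⟶ Z, v ≫ i = u) ↔ A.MemKOfL L u)
    (hKM : ∀ (T : Over S) (u : T ⟶ A.X), A.MemKOfL L u → u ^ M = 1)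
    {κ : Type u} (U : κ → S.Opens) (hU : TopologicalSpace.IsOpenCover U)
    (hdisj : ∀ k k', k ≠ k' → Disjoint (U k : Set S) (U k')) (hconn : ∀ k, PreconnectedSpace (U k))
    {Γ : Type*} [Group Γ] [Finite Γ] (e : ∀ k, A.kOfL L hL hε (Over.mk (U k).ι) ≃* Γ) :
    ∃ (K' : Subgroup A.Sections) (_ : Finite K'),
      (∀ ⦃Ω : Type u⦄ [Field Ω] [IsAlgClosed Ω] (s : Spec (.of Ω) ⟶ S),
        Function.Injective fun σ : K' => A.restrict s (σ : A.Sections)) ∧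
      ∀ (T : Over S) (u : T ⟶ A.X), A.MemKOfL L u ↔
        ∃ 𝒱 : Scheme.OpenCover.{u} T.left, ∀ j, ∃ σ : K',
          𝒱.f j ≫ u.left = 𝒱.f j ≫ T.hom ≫ (σ : A.Sections).left := by
  classical
  have hpiece := fun k => by
    haveI := hconn k
    exact A.finite_kOfL_and_injective_and_memKOfL_iff_of_levelStructure_on_opens L hL hε φ incl hpow hlift hinj i
      hZ hKM (U k)
  obtain ⟨K', hfin, ha, hb, hc⟩ := A.exists_subgroup_sections_glue U hU hdisj
    (fun k => A.kOfL L hL hε (Over.mk (U k).ι)) e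
  -- members of `K′` lie in `K(L)(S)`: membership is local (pieces `U k`)
  have hK'mem : ∀ σ : A.Sections, σ ∈ K' → A.MemKOfL L σ := by
    intro σ hσ
    haveI : ∀ k, IsOpenImmersion (toUnit (Over.mk (U k).ι) : Over.mk (U k).ι ⟶ 𝟙_ (Over S)).left := fun k => by
      change IsOpenImmersion (U k).ι; infer_instance
    refine A.memKOfL_of_forall_comp L i hZ σ (fun k => Over.mk (U k).ι) (fun k => toUnit _) (fun t => ?_)
      (fun k => (A.mem_kOfL_iff hL hε _).1 (ha k σ hσ))
    obtain ⟨k, hk⟩ := TopologicalSpace.Opens.mem_iSup.mp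
      (show t ∈ ⨆ k, U k by rw [hU.iSup_eq_top]; trivial)
    exact ⟨k, ⟨t, hk⟩, rfl⟩
  refine ⟨K', hfin, ?_, fun T u => ⟨fun hu => ?_, fun h => ?_⟩⟩
  · -- injectivity on geometric fibres: a geometric point lands in one piece
    intro Ω _ _ s σ τ hστ
    have hs0 : s.base (IsLocalRing.closedPoint Ω) ∈ (⨆ k, U k) := by rw [hU.iSup_eq_top]; trivial
    obtain ⟨k, hk⟩ := TopologicalSpace.Opens.mem_iSup.mp hs0
    have hrange : Set.range s ⊆ Set.range (U k).ι := by
      rintro _ ⟨p, rfl⟩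
      rw [Subsingleton.elim p (IsLocalRing.closedPoint Ω), Scheme.Opens.range_ι]
      exact hk
    obtain ⟨c, hcs⟩ : ∃ c : Spec (.of Ω) ⟶ (U k : Scheme.{u}), c ≫ (U k).ι = s :=
      ⟨IsOpenImmersion.lift (U k).ι s hrange, IsOpenImmersion.lift_fac _ _ _⟩
    subst hcs
    apply Subtype.ext
    apply hc k σ.1 τ.1 σ.2 τ.2
    have hinjk := (hpiece k).2.1 c
    have key : ∀ ρ : A.Sections, A.restrict (c ≫ (U k).ι) ρ =
        (Over.homMk c rfl : Over.mk (c ≫ (U k).ι) ⟶ Over.mk (U k).ι) ≫ (toUnit (Over.mk (U k).ι) ≫ ρ) := fun ρ => by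
      rw [← Category.assoc]
      exact congrArg (· ≫ ρ) (Subsingleton.elim _ _)
    have h' : (Over.homMk c rfl : Over.mk (c ≫ (U k).ι) ⟶ Over.mk (U k).ι) ≫
        ((⟨_, ha k σ.1 σ.2⟩ : A.kOfL L hL hε (Over.mk (U k).ι)) : Over.mk (U k).ι ⟶ A.X) =
        (Over.homMk c rfl : Over.mk (c ≫ (U k).ι) ⟶ Over.mk (U k).ι) ≫
        ((⟨_, ha k τ.1 τ.2⟩ : A.kOfL L hL hε (Over.mk (U k).ι)) : Over.mk (U k).ι ⟶ A.X) := by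
      change A.restrict (c ≫ (U k).ι) σ.1 = A.restrict (c ≫ (U k).ι) τ.1 at hστ
      rw [key, key] at hστ
      exact hστ
    exact congrArg Subtype.val (hinjk h')
  · -- (⇒) refine by the preimages of the pieces and read the split form on each
    let W : κ → T.left.Opens := fun k => T.hom ⁻¹ᵁ (U k)
    have hW : TopologicalSpace.IsOpenCover W := by
      refine TopologicalSpace.IsOpenCover.mk (top_le_iff.mp fun t _ => ?_)
      have ht : T.hom t ∈ (⨆ k, U k) := by rw [hU.iSup_eq_top]; trivial
      obtain ⟨k, hk⟩ := TopologicalSpace.Opens.mem_iSup.mp ht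
      exact TopologicalSpace.Opens.mem_iSup.mpr ⟨k, hk⟩
    let 𝒲 : T.left.OpenCover := T.left.openCoverOfIsOpenCover W hW
    -- on the piece `W k`, `u` lies over `U k`
    have hloc : ∀ k, ∃ 𝒱k : Scheme.OpenCover.{u} (W k : Scheme.{u}), ∀ j, ∃ σ : K',
        𝒱k.f j ≫ (W k).ι ≫ u.left = 𝒱k.f j ≫ ((W k).ι ≫ T.hom) ≫ (σ : A.Sections).left := by
      intro k
      let uk : Over.mk ((W k).ι ≫ T.hom) ⟶ A.X := Over.homMk (W k).ι rfl ≫ u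
      have huk : A.MemKOfL L uk := A.memKOfL_comp hL _ _ hu
      have hT : (T.hom ∣_ U k) ≫ (U k).ι = (Over.mk ((W k).ι ≫ T.hom)).hom := morphismRestrict_ι _ _
      obtain ⟨𝒱k, h𝒱k⟩ := ((hpiece k).2.2 _ uk (T.hom ∣_ U k) hT).1 huk
      refine ⟨𝒱k, fun j => ?_⟩
      obtain ⟨τ, hτ⟩ := h𝒱k j
      obtain ⟨σ, hσK, hστ⟩ := hb k τ.1 τ.2
      refine ⟨⟨σ, hσK⟩, ?_⟩
      have e3 : ((τ : A.kOfL L hL hε (Over.mk (U k).ι)) : Over.mk (U k).ι ⟶ A.X).left =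
          (U k).ι ≫ (σ : A.Sections).left := by
        rw [← hστ]; rfl
      have h4 := hτ
      rw [e3] at h4
      have h5 : (T.hom ∣_ U k) ≫ (U k).ι ≫ (σ : A.Sections).left = ((W k).ι ≫ T.hom) ≫ (σ : A.Sections).left := by
        rw [← Category.assoc, morphismRestrict_ι]
      exact h4.trans (congrArg (fun f : (W k : Scheme.{u}) ⟶ A.X.left => 𝒱k.f j ≫ f) h5)
    choose 𝒱k h𝒱k using hloc
    refine ⟨𝒲.bind 𝒱k, fun jk => ?_⟩
    obtain ⟨k, j⟩ := jk
    obtain ⟨σ, hσ⟩ := h𝒱k k j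
    refine ⟨σ, ?_⟩
    change (𝒱k k).f j ≫ (W k).ι ≫ u.left = ((𝒱k k).f j ≫ (W k).ι) ≫ T.hom ≫ (σ : A.Sections).left
    rw [hσ]; simp only [Category.assoc]
  · -- (⇐) locally `u` is the restriction of a member of `K′ ⊆ K(L)(S)`; membership is local
    obtain ⟨𝒱, h𝒱⟩ := h
    choose σ hσ using h𝒱
    haveI : ∀ j, IsOpenImmersion (Over.homMk (𝒱.f j) rfl : Over.mk (𝒱.f j ≫ T.hom) ⟶ T).left := fun j => by
      change IsOpenImmersion (𝒱.f j); infer_instance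
    refine A.memKOfL_of_forall_comp L i hZ u (fun j => Over.mk (𝒱.f j ≫ T.hom)) (fun j => Over.homMk (𝒱.f j) rfl)
      (fun t => ?_) (fun j => ?_)
    · obtain ⟨y, hy⟩ := 𝒱.covers t
      exact ⟨𝒱.idx t, y, hy⟩
    · have heq : Over.homMk (𝒱.f j) rfl ≫ u = toUnit (Over.mk (𝒱.f j ≫ T.hom)) ≫ (σ j : A.Sections) :=
        Over.OverMorphism.ext (by
          change 𝒱.f j ≫ u.left = (𝒱.f j ≫ T.hom) ≫ (σ j : A.Sections).left
          rw [hσ j, Category.assoc])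
      rw [heq]
      exact A.memKOfL_comp hL _ _ (hK'mem _ (σ j).2)

end AbelianSchemeOver

end Literature.AlgebraicGeometry.AbelianSchemes

end
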